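import Summits.QuantumFields.YangMills.Theorems.BalabanUVNodesN20CoreEdgeAtPersistentKeys
import Summits.QuantumFields.YangMills.Theorems.BalabanUVNodesN20TwoRunKeyedGoodFibre

/-!
# BalabanUVNodes ∕ N20 (NE7b) — the `hedge`-JOINT COMPANION, module 4: at the persistence class N19's core edge is «run A's TERM vs run B's ONE LIFTED TERM»
# (module 2's termwise sandwich, its run-B fibre sum collapsed to `liftSeq s` by n20-w2's good-class singleton) — loss-free

Cell `pub-ymgap` (HUMAN RULING D-0062 Track A; D-0149 width push), seat `pub-ymgap-dag-n20-w3` (WIDTH SEAT 3 of 3 on NODE n20 = NE7b) gen 0; continuation of modules 1–3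
(`Thm/BalabanUVNodesN20CoreEdgeTwoRunKeyed` p584566 · `…N20CoreEdgeAtPersistentKeys` p585901 · `…N20TruncSeqFibreLevelOne`) and of n20-w2's `Thm/BalabanUVNodesN20TwoRunKeyedGoodFibre`
(p586099).  Filed `--kind proof --supports stmt-QuantumFields-20544 --as helper`; COUNT-NEUTRAL.  [III] = [Balaban1988Convergent], [LF-II] = [Balaban1989LargeFieldII].

WHY THIS FILE.  Module 2 ★★ `core_twoRunKeyed_badKeysSigma_iff_termwise` displays N19's core edge at n19-d's σ-packed two-run keyed data with the SHARED bad class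
`Bad K t := badKeysSigma F (T K) jcut` (= `crOfRecord₁₃.Bad`, dag-n20-d l.24693) as a sandwich of run A's (2.18) term `s` against the SUM of run B's terms over the block-down
fibre `{s′ : truncSeq s′ = s}`, asked only of the run-A sequences with `s.Λ_j = T_η` for `1 ≤ j ≤ jcut K`.  n20-w2's `…GoodFibre` proves that on exactly those sequences
(policy `1 ≤ jcut K ≤ K₀ + K`: then `s.Λ_1 = T_η`, hence `s.Ω_1 = T_η`) the fibre is the SINGLETON `{liftSeq s}` — dag-n20-d's section of `Node00/TwoRunSiteLift` («level 1 :=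
the whole torus, the other entries blocked up»).  This file puts the two together:
* ★★ `core_twoRunKeyed_badKeysSigma_iff_liftedTerm` — at the persistence class, `NE7.Core l₀ vol T Bad (A − shA) (B − shB) δ` IFF for every `K` ONE constant `c` such that for
  every `|t| ≤ l₀` and every run-A sequence `s` with NO large-field region at the old levels `≤ jcut K`:
  `e^{c − vol·δ K}·(a K t s − shA K t ⟨K, kA s⟩) ≤ b K t (liftSeq s) − shB K t ⟨K, kA s⟩ ≤ e^{c + vol·δ K}·(a K t s − shA K t ⟨K, kA s⟩)` — run A's term for the history `s`
  at cutoff `K₀ + K` against run B's term for THE SAME history read one level up (no level-1 large field) at cutoff `K₀ + K + 1`; no fibre sum left;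
* ★★ `coreEdge_twoRunKeyed_badKeysSigma_of_liftedTerm` — B :169's `hedge` binder at that `Bad` from the lifted-term sandwich + `Summable δ`.
This is the sharpest display of what N19's core edge asks AT THE RECORD's class: a two-cutoff comparison of ONE small-field-at-old-levels history, term by term, modulo
one constant per `K` — the content the N19 ∕ U4′ pens must supply (rates NE1′–NE5 along the common small-field flow, the recent window `j > jcut K` free).

(α) READING ∕ LOCATED banner: as in module 2 — the class reads «old AND pending» iff the record's 𝐑-selector `θ.ppSel` is history-rewriting ((ρ2), the design); under an
identity∕junk pin it is «ever created» and `h20` at it is asymptotically unsatisfiable (evidence #10 on stmt-QuantumFields-20544; dag-n20-d CONFIRMED l.24693).  NC-NE7b-α UNRULED.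

HONEST FRAMING.  Count-neutral finite bookkeeping (module 2 + n20-w2's singleton BY NAME; nothing re-typed).  It proves NO estimate: the lifted-term sandwich for Bałaban's
class weights is N19's NE7 core content — NOT PRINTED for `d = 4` ([LF-II] p.356), NOT proved, NAMED OPEN; A6: LOCATED (an `iff`, not vacuous as a statement).  NE7 ∕ NE7b NOT
PRINTED ∕ NOT PROVED; (α)-instance 0∕1; N19 ∕ N20 NOT discharged; K3⁷ NOT closed; counts unmoved (typed 28∕28 · discharged 5∕27); no count claim.  One finite `𝕋⁴_{L^K}`
programme at fixed `ε = L^{−K}` along two consecutive cutoffs, Bałaban AS PRINTED; the YM mass gap (Clay) is NOT proved by any of this — R4 closes the conditional finite-𝕋⁴ rung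
`BalabanLadder.UV` only; NOT ℝ⁴, NOT OS.  No `instance`, no `notation`, no `def`, no `sorry`.
Sources (bookkeeping): [III] (2.1) p.254, (2.18) p.257; [LF-II] Thm 1 + (0.1) pp.355–356, (1.80) p.384; [King1986] (3.10) p.656.
-/

noncomputable section

namespace Summit.QuantumFields.YangMills.BalabanUVNodes.N20CoreEdgeLiftedTerm

open Literature.MathematicalPhysics.QuantumFieldTheory.Balaban1983to89 Literature.MathematicalPhysics.QuantumFieldTheory.Balaban1983to89.Node00
open scoped BigOperators
open T4Continuum B14.Eq218Concrete Summit.QuantumFields.BalabanUV.T4Continuum.Spine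
open Summit.QuantumFields.YangMills.BalabanUVNodes.N20CoreEdgeAtPersistentKeys (core_twoRunKeyed_badKeysSigma_iff_termwise)
open Summit.QuantumFields.YangMills.BalabanUVNodes.N20TwoRunKeyedGoodFibre (filter_truncSeq_eq_singleton_liftSeq)

variable (F : T4Family) (ν : Stage7Numerics) (K₀ : ℕ) {M : ℕ} (hM : 0 < M) {gA gB : ℕ → ℕ → ℝ}

/-- On a run-A sequence with no large-field region at the old levels `≤ jcut K` (policy `1 ≤ jcut K ≤ K₀ + K`) the first domains are the whole torus: `s.Λ_1 = T_η` and
`s.Ω_1 = T_η` ((2.1): `Λ_1 ⊆ Ω_1`, dag-n20-d's `seq_Ω_eq_univ_of_Λ_eq_univ`). [cite: Balaban1988Convergent, (2.1) p.254 (bookkeeping)] -/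
theorem Ω_one_eq_univ_of_smallFieldHistory {K : ℕ} {jcut : ℕ → ℕ} (hj1 : 1 ≤ jcut K) (hjK : jcut K ≤ K₀ + K)
    (s : SeqOfRecord F ν M (gA K) (K₀ + K) (K₀ + K)) (hgood : ∀ j, 1 ≤ j → j ≤ jcut K → s.Λ j = Set.univ) : s.Ω 1 = Set.univ :=
  seq_Ω_eq_univ_of_Λ_eq_univ s le_rfl (hj1.trans hjK) (hgood 1 le_rfl hj1)

variable [∀ Kc, DecidableEq (SiteSeqKey F Kc)]

open Classical in
/-- **★★ AT THE PERSISTENCE CLASS, N19's CORE EDGE IS «RUN A's TERM vs RUN B's ONE LIFTED TERM» — LOSS-FREE.**  B :169's keyed data with `Bad K t := badKeysSigma F (T K) jcut`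
(policy `1 ≤ jcut K ≤ K₀ + K` DISPLAYED), flow hypothesis `hR`; weights `a`, `b`, shells, `δ` generic.  `NE7.Core l₀ vol T Bad (A − shA) (B − shB) δ` IFF for every `K` ONE constant
`c` such that for every `|t| ≤ l₀` and every run-A (2.18) sequence `s` at cutoff `K₀ + K` with `s.Λ_j = T_η` for all `1 ≤ j ≤ jcut K`:
`e^{c − vol·δ K}·(a K t s − shA K t ⟨K, kA s⟩) ≤ b K t (liftSeq s) − shB K t ⟨K, kA s⟩ ≤ e^{c + vol·δ K}·(a K t s − shA K t ⟨K, kA s⟩)` — module 2's fibre sum collapsed by n20-w2's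
`filter_truncSeq_eq_singleton_liftSeq` (the fibre over such an `s` is `{liftSeq s}`).  The right-hand side for Bałaban's class weights is N19's NE7 core on small-field-at-old-levels
histories — NOT PRINTED, NOT proved. [cite: King1986, (3.10) p.656; Balaban1989LargeFieldII, Thm 1 + (0.1) pp.355–356, (1.80) p.384; Balaban1988Convergent, (2.1) p.254, (2.18) p.257 (bookkeeping)] -/
theorem core_twoRunKeyed_badKeysSigma_iff_liftedTerm (hR : ∀ K, RAgree F ν (gA K) (gB K) (K₀ + K)) (jcut : ℕ → ℕ)
    (hj1 : ∀ K, 1 ≤ jcut K) (hjK : ∀ K, jcut K ≤ K₀ + K) {l₀ vol : ℝ}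
    (a : (K : ℕ) → ℝ → SeqOfRecord F ν M (gA K) (K₀ + K) (K₀ + K) → ℝ) (b : (K : ℕ) → ℝ → SeqOfRecord F ν M (gB K) (K₀ + K + 1) (K₀ + K + 1) → ℝ)
    (shA shB : ℕ → ℝ → (Σ K, SiteSeqKey F (K₀ + K)) → ℝ) (δ : ℕ → ℝ) :
    NE7.Core l₀ vol
        (fun K => Finset.univ.image (fun s : SeqOfRecord F ν M (gA K) (K₀ + K) (K₀ + K) =>
            (⟨K, twoRunKeyA F ν M (gA K) (K₀ + K) (K₀ + K) s⟩ : Σ K, SiteSeqKey F (K₀ + K)))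
          ∪ Finset.univ.image (fun s' : SeqOfRecord F ν M (gB K) (K₀ + K + 1) (K₀ + K + 1) =>
            (⟨K, twoRunKeyB F ν hM (gB K) (K₀ + K) (K₀ + K) s'⟩ : Σ K, SiteSeqKey F (K₀ + K))))
        (fun K _ => badKeysSigma F
          (Finset.univ.image (fun s : SeqOfRecord F ν M (gA K) (K₀ + K) (K₀ + K) =>
              (⟨K, twoRunKeyA F ν M (gA K) (K₀ + K) (K₀ + K) s⟩ : Σ K, SiteSeqKey F (K₀ + K)))
            ∪ Finset.univ.image (fun s' : SeqOfRecord F ν M (gB K) (K₀ + K + 1) (K₀ + K + 1) =>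
              (⟨K, twoRunKeyB F ν hM (gB K) (K₀ + K) (K₀ + K) s'⟩ : Σ K, SiteSeqKey F (K₀ + K)))) jcut)
        (fun K t x => (∑ s ∈ Finset.univ.filter (fun s : SeqOfRecord F ν M (gA K) (K₀ + K) (K₀ + K) =>
            (⟨K, twoRunKeyA F ν M (gA K) (K₀ + K) (K₀ + K) s⟩ : Σ K, SiteSeqKey F (K₀ + K)) = x), a K t s) - shA K t x)
        (fun K t x => (∑ s' ∈ Finset.univ.filter (fun s' : SeqOfRecord F ν M (gB K) (K₀ + K + 1) (K₀ + K + 1) =>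
            (⟨K, twoRunKeyB F ν hM (gB K) (K₀ + K) (K₀ + K) s'⟩ : Σ K, SiteSeqKey F (K₀ + K)) = x), b K t s') - shB K t x) δ
      ↔ ∀ K : ℕ, ∃ c : ℝ, ∀ t : ℝ, |t| ≤ l₀ → ∀ s : SeqOfRecord F ν M (gA K) (K₀ + K) (K₀ + K),
          (∀ j, 1 ≤ j → j ≤ jcut K → s.Λ j = Set.univ) →
          Real.exp (c - vol * δ K) * (a K t s - shA K t ⟨K, twoRunKeyA F ν M (gA K) (K₀ + K) (K₀ + K) s⟩)
              ≤ b K t (liftSeq F ν hM (hR K) s) - shB K t ⟨K, twoRunKeyA F ν M (gA K) (K₀ + K) (K₀ + K) s⟩ ∧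
            b K t (liftSeq F ν hM (hR K) s) - shB K t ⟨K, twoRunKeyA F ν M (gA K) (K₀ + K) (K₀ + K) s⟩
              ≤ Real.exp (c + vol * δ K) * (a K t s - shA K t ⟨K, twoRunKeyA F ν M (gA K) (K₀ + K) (K₀ + K) s⟩) := by
  rw [core_twoRunKeyed_badKeysSigma_iff_termwise F ν K₀ hM hR jcut a b shA shB δ]
  refine forall_congr' fun K => exists_congr fun c => forall_congr' fun t => forall_congr' fun _ => forall_congr' fun s =>
    forall_congr' fun hgood => ?_
  rw [filter_truncSeq_eq_singleton_liftSeq F ν hM (hR K) ((hj1 K).trans (hjK K)) s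
    (Ω_one_eq_univ_of_smallFieldHistory F ν K₀ (hj1 K) (hjK K) s hgood), Finset.sum_singleton]

open Classical in
/-- **★★ B :169's `hedge` BINDER AT THE PERSISTENCE CLASS FROM THE LIFTED-TERM SANDWICH** (`Summable δ` added): DISPLAYED `hR`, the policy `jcut` with `1 ≤ jcut K ≤ K₀ + K`,
`hδ`, and the sandwich «run A's term `s` vs run B's lifted term `liftSeq s`» on the run-A sequences that are small-field at every old level — nothing else.
[cite: King1986, (3.10) p.656; Balaban1989LargeFieldII, Thm 1 + (0.1) pp.355–356; Balaban1988Convergent, (2.18) p.257 (bookkeeping)] -/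
theorem coreEdge_twoRunKeyed_badKeysSigma_of_liftedTerm (hR : ∀ K, RAgree F ν (gA K) (gB K) (K₀ + K)) (jcut : ℕ → ℕ)
    (hj1 : ∀ K, 1 ≤ jcut K) (hjK : ∀ K, jcut K ≤ K₀ + K) {l₀ vol : ℝ}
    (a : (K : ℕ) → ℝ → SeqOfRecord F ν M (gA K) (K₀ + K) (K₀ + K) → ℝ) (b : (K : ℕ) → ℝ → SeqOfRecord F ν M (gB K) (K₀ + K + 1) (K₀ + K + 1) → ℝ)
    (shA shB : ℕ → ℝ → (Σ K, SiteSeqKey F (K₀ + K)) → ℝ) {δ : ℕ → ℝ} (hδ : Summable δ)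
    (hlift : ∀ K : ℕ, ∃ c : ℝ, ∀ t : ℝ, |t| ≤ l₀ → ∀ s : SeqOfRecord F ν M (gA K) (K₀ + K) (K₀ + K),
      (∀ j, 1 ≤ j → j ≤ jcut K → s.Λ j = Set.univ) →
      Real.exp (c - vol * δ K) * (a K t s - shA K t ⟨K, twoRunKeyA F ν M (gA K) (K₀ + K) (K₀ + K) s⟩)
          ≤ b K t (liftSeq F ν hM (hR K) s) - shB K t ⟨K, twoRunKeyA F ν M (gA K) (K₀ + K) (K₀ + K) s⟩ ∧
        b K t (liftSeq F ν hM (hR K) s) - shB K t ⟨K, twoRunKeyA F ν M (gA K) (K₀ + K) (K₀ + K) s⟩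
          ≤ Real.exp (c + vol * δ K) * (a K t s - shA K t ⟨K, twoRunKeyA F ν M (gA K) (K₀ + K) (K₀ + K) s⟩)) :
    ∃ δ : ℕ → ℝ, NE7.Core l₀ vol
        (fun K => Finset.univ.image (fun s : SeqOfRecord F ν M (gA K) (K₀ + K) (K₀ + K) =>
            (⟨K, twoRunKeyA F ν M (gA K) (K₀ + K) (K₀ + K) s⟩ : Σ K, SiteSeqKey F (K₀ + K)))
          ∪ Finset.univ.image (fun s' : SeqOfRecord F ν M (gB K) (K₀ + K + 1) (K₀ + K + 1) =>
            (⟨K, twoRunKeyB F ν hM (gB K) (K₀ + K) (K₀ + K) s'⟩ : Σ K, SiteSeqKey F (K₀ + K))))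
        (fun K _ => badKeysSigma F
          (Finset.univ.image (fun s : SeqOfRecord F ν M (gA K) (K₀ + K) (K₀ + K) =>
              (⟨K, twoRunKeyA F ν M (gA K) (K₀ + K) (K₀ + K) s⟩ : Σ K, SiteSeqKey F (K₀ + K)))
            ∪ Finset.univ.image (fun s' : SeqOfRecord F ν M (gB K) (K₀ + K + 1) (K₀ + K + 1) =>
              (⟨K, twoRunKeyB F ν hM (gB K) (K₀ + K) (K₀ + K) s'⟩ : Σ K, SiteSeqKey F (K₀ + K)))) jcut)
        (fun K t x => (∑ s ∈ Finset.univ.filter (fun s : SeqOfRecord F ν M (gA K) (K₀ + K) (K₀ + K) =>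
            (⟨K, twoRunKeyA F ν M (gA K) (K₀ + K) (K₀ + K) s⟩ : Σ K, SiteSeqKey F (K₀ + K)) = x), a K t s) - shA K t x)
        (fun K t x => (∑ s' ∈ Finset.univ.filter (fun s' : SeqOfRecord F ν M (gB K) (K₀ + K + 1) (K₀ + K + 1) =>
            (⟨K, twoRunKeyB F ν hM (gB K) (K₀ + K) (K₀ + K) s'⟩ : Σ K, SiteSeqKey F (K₀ + K)) = x), b K t s') - shB K t x) δ ∧ Summable δ :=
  ⟨δ, (core_twoRunKeyed_badKeysSigma_iff_liftedTerm F ν K₀ hM hR jcut hj1 hjK a b shA shB δ).2 hlift, hδ⟩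

end Summit.QuantumFields.YangMills.BalabanUVNodes.N20CoreEdgeLiftedTerm

end
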